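import Summits.CriticalPhenomena.PercolationContinuityZ3.Theorems.Transplant.KNCellsStepsFail
import Summits.CriticalPhenomena.PercolationContinuityZ3.Theorems.Transplant.KNCellsStepsReach
import Summits.CriticalPhenomena.PercolationContinuityZ3.Theorems.Transplant.KNCellsExit
import HarnessLib

/-!
# F8 (generic), the node theorem over anchored cells — ONE statement for the instances: geometry + (32) at the root + the target lemma at the
# faces + the pattern-pinned corridor lemma + the face-prefix geometry ⟹ `SameP.SamePWitnessAt G root p`
# (BLUEPRINT-I-PHI §3 Φ11–Φ13 assembled; design HOME/prim-bschramm-p2-g2/F8-DESIGN.md)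

builds on p205010 (kernel theorem, internal audit signed; external expert review pending) — nothing in this file uses p205010.
Lane `prim-bschramm`, seat `prim-bschramm-p2` (task F8); helper file (`--supports stmt-CriticalPhenomena-4575`).

`KSchA.samePWitnessAt_of_cells` (KNCellsExit) needs the failure bound (33) after valid histories; `KSchA.fail_bound` (KNCellsStepsFail) derives it
from the per-direction, per-anchor inputs (I1)–(I3); `KSchA.sum_real_Reach_compl_inter_Dev_le` (KNCellsStepsReach) derives the summed corridor
input (I1) from (32) — which every valid history carries (`Valid.reach`) — and the pattern-pinned Lemma 12.  This file composes the three: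
**`samePWitnessAt_of_cellKit`**.  Its hypotheses are exactly what an instance (X □ ℤ²: p3-g2's `KNCellsBoxProdZ2` + kits; a planar skeleton;
the `ℤ^d` regression) and the generic Lemma-12-over-cells (stmt's Corridor) must supply; its conclusion is the node `SameP.SamePWitnessAt`.
[cite: KozmaNitzan2024, §4 Theorem 6 (pp. 25–31) — the ℤ^d model] [cite: GrimmettPercolation1999, §7.2]
-/

noncomputable section

open MeasureTheory ProbabilityTheory
open scoped ENNReal Classical

namespace Summit.CriticalPhenomena.PercolationContinuityZ3.Theorems

namespace Transplant

namespace KNCells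

open Literature.Probability.Percolation Literature.Probability.LatticeModels SimpleGraph GadgetSystem ProbeHistory HSiteScheme Contour

variable {V : Type*} [DecidableEq V] [Countable V]

namespace KSchA

variable {A : Type*} {G : SimpleGraph V} [G.LocallyFinite] {S : KSchA V A} {FD : FaceData V A}

/-- **THE NODE OVER ANCHORED CELLS.**  Let `S` be anchored scheme parameters on `G` (countable, locally finite, degrees `≤ Δ`) with face data,
satisfying the geometric facts `RunGeom`, `SepGeom`, `ExitGeom`, `StepsGeom`, an envelope-region bound `B`, `δc ≤ 1`; assume
(32) at the root cell (`hQ0`), and for every VALID history `h`, chosen edge `e` (source anchor `a = aOf h e`), onward direction `du`: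
(I3) the face-prefix consequences at every admissible departure anchor, (I2) the target lemma at the faces under the weighting of (30) with
`δ_{L10} = δ₂ ≤ 1`, and (I1) Lemma 12 under `μ` pinned along every GOOD pattern of the fresh edges of `E_i ∪ E_{w,v}` with loss `ε''`; and the
constants satisfy `4((1-δ₂)^K + (ε'' + δc)) ≤ ε < 2⁻³²`.  Then `SameP.SamePWitnessAt G root p`.
[cite: KozmaNitzan2024, §4 Theorem 6 (pp. 25–31)] -/
theorem samePWitnessAt_of_cellKit (hΓ : RunGeom G S.Γ) (hsep : SepGeom G S.Γ) (hX : ExitGeom G S.Γ) (hSt : StepsGeom S.Γ FD)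
    {Δ B : ℕ} (hΔ : ∀ x, G.degree x ≤ Δ)
    (hB : ∀ (h : ProbeHistory V) (e : Site 2 × MDir) (a : A), (S.envRegion G h e a).card ≤ B)
    (hδc : S.δc ≤ 1) {ε ε'' δ₂ : ℝ} (hε : ε < (1 / 2) ^ 32) (hε'' : 0 ≤ ε'') (hδ₂ : δ₂ ≤ 1)
    (hKε : 4 * ((1 - δ₂) ^ S.Γ.K + (ε'' + S.δc)) ≤ ε)
    (hQ0 : ∀ du : MDir, 1 - S.δc < (prodBernoulli (pinW (KNLevels.lattW G S.p) ↑(S.U₀ G) ↑(S.U₀ G))).real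
      (⋃ t ∈ (↑(S.Γ.M S.Γ.a₀ ((0 : Site 2) + stepVec du)) : Set V),
        openConnIn (↑(S.Γ.Q S.Γ.a₀ 0 ∪ S.Γ.Ewv S.Γ.a₀ 0 du) : Set V) S.Γ.root t))
    (hP1 : ∀ h e, S.Valid G h e → ∀ du ∈ S.onward G h (tgt e), ∀ a' ∈ S.Γ.anchSet (S.aOf G h e) (tgt e), ∀ ω,
      ω ∈ KNLevels.lattOnly G (S.Vx G h ∪ S.Γ.Ewv (S.aOf G h e) e.1 e.2 ∪ FD.Hfull a' (tgt e) du) →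
      ω ∈ S.Reach G FD h e (S.aOf G h e) a' du → ω ∈ S.Aface G FD h e (S.aOf G h e) a' du (S.Γ.K - 1))
    (hP2 : ∀ h e, S.Valid G h e → ∀ du ∈ S.onward G h (tgt e), ∀ a' ∈ S.Γ.anchSet (S.aOf G h e) (tgt e), ∀ ω j, 1 ≤ j → j < S.Γ.K →
      ω ∈ KNLevels.lattOnly G (S.Vx G h ∪ S.Γ.Ewv (S.aOf G h e) e.1 e.2 ∪ S.Γ.Stub a' (tgt e) du (j + 1)) →
      ω ∈ S.Aface G FD h e (S.aOf G h e) a' du j → ω ∈ S.Aface G FD h e (S.aOf G h e) a' du (j - 1))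
    (hface : ∀ h e, S.Valid G h e → ∀ du ∈ S.onward G h (tgt e), ∀ a' ∈ S.Γ.anchSet (S.aOf G h e) (tgt e), ∀ j < S.Γ.K,
      ∀ o : Finset (Sym2 V),
      1 - δ₂ < (prodBernoulli (S.Wt G h e (S.aOf G h e) a' du j o)).real (⋃ b ∈ FD.Face a' (tgt e) du (j + 1), openConn S.Γ.root b) →
        S.cond G h e (S.aOf G h e) a' du j o)
    (hcorr : ∀ h e, S.Valid G h e → ∀ du ∈ S.onward G h (tgt e), ∀ P ⊆ S.Bfr G h e (S.aOf G h e), S.GoodPat G h e (S.aOf G h e) P →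
      1 - ε'' < (prodBernoulli (pinW (S.Wfull G h e (S.aOf G h e) (S.patAnchor G h e (S.aOf G h e) P) du)
        ↑(S.Bfr G h e (S.aOf G h e)) ↑P)).real (S.Reach G FD h e (S.aOf G h e) (S.patAnchor G h e (S.aOf G h e) P) du)) :
    SameP.SamePWitnessAt G S.Γ.root S.p := by
  refine samePWitnessAt_of_cells hΓ hsep hX hΔ hB hδc hε hQ0 fun h e hV => ?_
  have hε' : 0 ≤ ε'' + S.δc := by
    have : 0 ≤ S.δc := by
      -- `1 - δc < P(…) ≤ 1`
      have h1 := hV.reach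
      linarith [measureReal_le_one (μ := prodBernoulli (S.W₀ G h e ((S.astOf G h).dep e.1)))
        (s := ⋃ t ∈ S.Γ.M ((S.astOf G h).dep e.1) (tgt e), openConn S.Γ.root t)]
    linarith
  refine (fail_bound hV hSt hε' hδ₂ (hP1 h e hV) (hP2 h e hV) (hface h e hV) fun du hdu => ?_).trans hKε
  exact sum_real_Reach_compl_inter_Dev_le hV hSt hε'' hV.reach (hcorr h e hV du hdu)

end KSchA

end KNCells

end Transplant

end Summit.CriticalPhenomena.PercolationContinuityZ3.Theorems

end
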